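import Summits.PneNP.PneNP.Theorems.PhaseTwinsNoFBPPApproxAboveUniquenessFprasDecider
import Summits.PneNP.PneNP.Theorems.PhaseTwinsNoFBPPApproxAboveUniquenessFactFreeAssembly
import Summits.PneNP.PneNP.Theorems.PhaseTwinsPseudorandomTwinsAboveGapE3SATB

/-!
# The fact-free corner of crux stmt-PneNP-2717, composed: FPRASes for the hard-core count at every admissible `(Δ, p, q)` give `NP ⊆ BPP`

Line `SketchIdeator1`: the assembly `stub_factFreeAssembly` (landed) with its two hypotheses discharged by the
landed decider `stub_fprasDecider` (FF2) and the landed bounded-occurrence gap-E3SAT hardness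
`Summit.PneNP.PneNP.Theorems.stub_gapE3SATB` (line of crux stmt-PneNP-2721; PCP theorem proved in the tree).
No named fact is used: this REPLACES the vendored GŠV16 Thm 1 (`NP_eq_RP_of_hardcoreFPRAS`) wherever only the
family of FPRASes above the threshold is available — in particular in the calibration of the crux.
-/

set_option linter.dupNamespace false

namespace Summit.PneNP.PneNP.Theorems.NoFBPPApproxAboveUniqueness

open Literature.Computability.Complexity Literature.Probability.LatticeModels

/-- **The fact-free corner.** If `hardcoreCount Δ p q` has an FPRAS at every admissible `(Δ, p, q)` then
`NP ⊆ BPP` (registered sub-goal `NP_subset_BPP_of_hardcoreFPRAS_everywhere`). [cite: Sly2010, §1 (zero-temperature limit)] -/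
theorem NP_subset_BPP_of_hardcoreFPRAS_everywhere : (∀ Δ p q : ℕ, 3 ≤ Δ → 0 < q → hardCoreThreshold Δ < (p : ℝ) / q → HasFPRAS (hardcoreCount Δ p q)) → Nondeterministic.NP ⊆ BPP :=
  fun hall => stub_factFreeAssembly (fun hf hh hF c K => stub_fprasDecider hf hh hF c K)
    Summit.PneNP.PneNP.Theorems.stub_gapE3SATB hall

end Summit.PneNP.PneNP.Theorems.NoFBPPApproxAboveUniqueness
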